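import Literature.MathematicalPhysics.QuantumFieldTheory.Balaban1983to89.B1Eq324BenfattoAppendixA
import Literature.MathematicalPhysics.QuantumFieldTheory.Balaban1983to89.B3CxiPropagator
import HarnessLib

/-!
# `Balaban1983to89.B1Eq324BenfattoCondCentre` — [BenfattoEtAl1978] Appendix C point 2), (C.7)–(C.8) p. 164: the CENTRE of
# the conditioned free field is bounded by the boundary data's profile, `|u_Δ| ≤ const·γb(1 + d(Δ, I))`, PROVED for the
# tree's regression mean `condMean (freeCov d α β) Γ z̄` by the massive maximum principle on `ℤ^d`

statement-level skeleton of published theorems with citation tags; proofs where landed; nothing here is a claim about the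
Yang–Mills mass gap

WHY THIS MODULE (cell `pub-ymgap`, seat `dag-n08-b`, node N08 «first missing estimate» lane; follows `B1Eq324BenfattoAppendixA`
(App. A PROVED) and `B1Eq324BenfattoAppendixC` (App. C Lemma 1 PROVED)).  The last Gaussian input of §5's proof of the p. 152
Basic Lemma of [BenfattoEtAl1978] (behind [Balaban1982Higgs1] (3.24), behind [Balaban1985UV3] (24)/(58)) is App. C LEMMA 2, the
small-field volume of the CONDITIONED field; its one-line proof uses (C.6) (conditioning lowers the covariance) and (C.8), the
bound on the conditional centre.  This file proves a (C.8)-type bound for the tree's conditioned field.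

THE PRINTED TEXT (p. 164, verbatim, desk ME #23): *"2) Let Γ be a region paved by Q₀ and let P̂₀(dz|z_Γ) denotes the above
probability measure conditioned to fixed values of the z_Δ's, Δ ∈ Γ. Then the conditioned variables (z_Δ)_{Δ∉Γ} are a non
centered gaussian field with covariance C^Γ_{ΔΔ′} such that 0 ≦ C^Γ_{ΔΔ′} ≦ C_{ΔΔ′} (C.6) and center
u_Δ = β Σ_{Δ′⊂Γ} (Σ_{Δ″⊄Γ, Δ″ n.n. to Δ′} C^Γ_{ΔΔ″}) z_Δ′. (C.7)  C^Γ_{Δ,Δ′} is the covariance with “Dirichelet boundary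
condition” on Γ. Hence using (C.6) (C.3), if |z_Δ| < b(1 + d(Δ, I)): |u_Δ| ≦ ((α² + 2d)/α²)² b(1 + d(Δ, I)). (C.8) The above
properties are well-known [7]."*  (Lemma 2 p. 165 applies it to data `|z̄_Δ| ≦ γb(1 + d(I, Δ))` on Γ.)

DICTIONARY.  The conditioned field of the tree is `B1Eq324BenfattoLemma.condField d α β Γ z̄`, the Gaussian field with mean the
REGRESSION `u = condMean (freeCov d α β) Γ z̄`, `u(x) = Σ_{c,c′∈Γ} K(x,c)·(K_ΓΓ)⁻¹_{cc′}·z̄_{c′}` (`K = freeCov d α β`), and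
covariance `condCov` (Schur complement) — the generic formulae for a Gaussian vector given finitely many coordinates, which for the
Markov field (1.1) coincide with print's (C.7) / «Dirichelet» covariance.  This file bounds THAT `u`.

WHAT IS PROVED (no definition, no named fact, no `sorry`; axioms standard).  Route ≠ print's (which reads (C.8) off the walk
expansion (C.3)); here: **the massive maximum principle**.
* §1 the lattice equation of the free covariance: `negLapZ_one_CetaM_add` (`(−Δ₁ + α²)C¹_{α²} = δ₀`, from r15's momentum-integral
  identity `B3CxiPropagator.negLapZ_Cxi_add` by the rescaling `CetaM = M^{d−2}C^{M}`), `freeCov_lattice_eq`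
  (`(2d + α²)K(x,c) − Σ_{x′∼x} K(x′,c) = β⁻¹δ_{xc}`), `abs_freeCov_le` (`|K| ≤ 1/(βα²)`).
* §2 the regression mean as a kernel combination: `condMean_eq_sum_mul` (`u = Σ_c K(·,c)a_c`, `a = (K_ΓΓ)⁻¹z̄`),
  `condMean_apply_of_mem` (`u = z̄` on Γ when `K_ΓΓ` is invertible), private `condMean_eq_zero_of_not_isUnit` (Mathlib's `M⁻¹ = 0`
  for singular `M` makes `u ≡ 0` otherwise), `condMean_freeCov_harmonic` (`(2d + α²)u(x) = Σ_{x′∼x} u(x′)` off Γ), private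
  `abs_condMean_le_const` (`u` is bounded).
* §3 geometry: `abs_cubeDist_step_sub_le`, `abs_distToRegion_step_sub_le` — `d(Δ, I)` is 1-Lipschitz under unit steps of `Δ`.
* §4 private `le_of_subsolution` — maximum principle on `ℤ^d ∖ Γ` for BOUNDED subsolutions of `(2d + α²)w ≤ Σ_{x′∼x} w(x′)`, `α² > 0`
  (sup-argument; no attainment of the supremum is needed), and the main theorem **`abs_condMean_freeCov_le`**: for `α, β > 0`,
  `γb ≥ 0` and boundary data `|z̄_c| ≤ γb(1 + d(Δ_c, I))` on Γ, `|u(x)| ≤ γb(1 + d(Δₓ, I) + 2d/α²)` for EVERY `x` — whence the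
  (C.8) shape **`abs_condMean_freeCov_le'`**: `|u(x)| ≤ (1 + 2d/α²)·γb·(1 + d(Δₓ, I))` (print's constant is the square
  `((α²+2d)/α²)²`; the desk recorded a print-internal `α² ↔ 2d` transposition between (C.8) and Lemma 2's side condition —
  the typed constant here is the one this proof yields).

NOT HERE: (C.6) entrywise / (C.3) walk expansion / (C.2), (C.4), (C.5); Lemma 2 itself (needs, besides this file and
`B1Eq324BenfattoAppendixC.condCov_self_le`, that `condCov (freeCov …) Γ` is a positive semidefinite kernel — the generalized Schur
complement — to run the one-site tails of `B1Eq324BenfattoAppendixA` §1 on the conditioned field).  NOT summit progress;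
count-neutral for N08.
-/

noncomputable section

open Finset Matrix
open scoped BigOperators Matrix

namespace Literature.MathematicalPhysics.QuantumFieldTheory.Balaban1983to89.B1Eq324BenfattoCondCentre

open Literature.MathematicalPhysics.QuantumFieldTheory
open Literature.MathematicalPhysics.QuantumFieldTheory.Balaban1983to89.B3Sect3VectorSelfEnergy
open Literature.MathematicalPhysics.QuantumFieldTheory.Balaban1983to89.B3CxiPropagator
open Literature.MathematicalPhysics.QuantumFieldTheory.Balaban1983to89.B3WT226FreeLattice
open Literature.MathematicalPhysics.QuantumFieldTheory.Balaban1983to89.B1Eq324BenfattoLemma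
open Literature.MathematicalPhysics.QuantumFieldTheory.Balaban1983to89.B1Eq324BenfattoAppendixA

variable {d : ℕ}

/-! ## §1  The lattice equation of the free covariance `K = β⁻¹C¹_{α²}` -/

/-- **`(−Δ₁ + α²)C¹_{α²} = δ₀`** on `ℤ^d`: the infinite-volume propagator `CetaM d 1 (α²)` solves the resolvent equation of the
unit-lattice Laplacian (r15's `negLapZ_Cxi_add` for `C^ξ`, `ξ = α`, rescaled: `C¹_{α²} = α^{d−2}C^{α}`, `−Δ₁ = α²(−Δ^{α})`).
[cite: BenfattoEtAl1978, (1.1) p.144] -/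
theorem negLapZ_one_CetaM_add {α : ℝ} (hα : 0 < α) (z : ZSite d) :
    negLapZ 1 (CetaM d 1 (α ^ 2)) z + α ^ 2 * CetaM d 1 (α ^ 2) z = if z = 0 then 1 else 0 := by
  have hsq : Real.sqrt (α ^ 2) = α := Real.sqrt_sq hα.le
  have hC : CetaM d 1 (α ^ 2) = fun w => α ^ d / α ^ 2 * Cxi d α w := by
    funext w
    simp only [CetaM, hsq, one_mul]
  have hα0 : α ≠ 0 := hα.ne'
  rw [hC, negLapZ_const_mul, negLapZ_rescale (one_ne_zero) hα0, one_mul]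
  have key := negLapZ_Cxi_add (d := d) hα z
  have h2 : α ^ d / α ^ 2 * (α ^ 2 * negLapZ α (Cxi d α) z) + α ^ 2 * (α ^ d / α ^ 2 * Cxi d α z) =
      α ^ d * (negLapZ α (Cxi d α) z + Cxi d α z) := by
    field_simp
  rw [h2, key]
  by_cases hz : z = 0
  · rw [if_pos hz, if_pos hz, inv_pow, mul_inv_cancel₀ (pow_ne_zero d hα0)]
  · rw [if_neg hz, if_neg hz, mul_zero]

/-- `(−Δ₁f)(z) = 2d·f(z) − Σ_μ (f(z + e_μ) + f(z − e_μ))`. [folklore] -/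
private theorem negLapZ_one_eq (f : ZSite d → ℝ) (z : ZSite d) :
    negLapZ 1 f z = 2 * d * f z - ∑ μ : Fin d, (f (z + unitVec μ) + f (z - unitVec μ)) := by
  simp only [negLapZ, inv_one, one_pow, one_mul]
  have : ∑ μ : Fin d, (2 * f z - f (z + unitVec μ) - f (z - unitVec μ)) =
      ∑ _μ : Fin d, 2 * f z - ∑ μ : Fin d, (f (z + unitVec μ) + f (z - unitVec μ)) := by
    rw [← Finset.sum_sub_distrib]
    refine Finset.sum_congr rfl fun μ _ => ?_
    ring
  rw [this, Finset.sum_const, Finset.card_univ, Fintype.card_fin, nsmul_eq_mul]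
  ring

/-- **The lattice equation of the free covariance**: `(2d + α²)K(x, c) − Σ_μ (K(x + e_μ, c) + K(x − e_μ, c)) = β⁻¹·[x = c]`,
`K = freeCov d α β = β⁻¹C¹_{α²}(x − c)` (the precision of the field (1.1) is `β(−Δ + α²)`). [cite: BenfattoEtAl1978, (1.1) p.144] -/
theorem freeCov_lattice_eq {α : ℝ} (β : ℝ) (hα : 0 < α) (x c : B1Eq324BenfattoLemma.Site d) :
    (2 * d + α ^ 2) * freeCov d α β x c -
        ∑ μ : Fin d, (freeCov d α β (x + unitVec μ) c + freeCov d α β (x - unitVec μ) c) =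
      if x = c then β⁻¹ else 0 := by
  have key := negLapZ_one_CetaM_add (d := d) hα (x - c)
  rw [negLapZ_one_eq] at key
  have hshift : ∀ μ : Fin d, (x - c + unitVec μ = x + unitVec μ - c) ∧ (x - c - unitVec μ = x - unitVec μ - c) :=
    fun μ => ⟨by abel, by abel⟩
  simp only [freeCov]
  have hsum : ∑ μ : Fin d, (β⁻¹ * CetaM d 1 (α ^ 2) (x + unitVec μ - c) + β⁻¹ * CetaM d 1 (α ^ 2) (x - unitVec μ - c)) =
      β⁻¹ * ∑ μ : Fin d, (CetaM d 1 (α ^ 2) (x - c + unitVec μ) + CetaM d 1 (α ^ 2) (x - c - unitVec μ)) := by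
    rw [Finset.mul_sum]
    refine Finset.sum_congr rfl fun μ _ => ?_
    rw [(hshift μ).1, (hshift μ).2]
    ring
  rw [hsum]
  have hxc : (x = c) ↔ (x - c = 0) := sub_eq_zero.symm
  have hL : (2 * d + α ^ 2) * (β⁻¹ * CetaM d 1 (α ^ 2) (x - c)) -
      β⁻¹ * ∑ μ : Fin d, (CetaM d 1 (α ^ 2) (x - c + unitVec μ) + CetaM d 1 (α ^ 2) (x - c - unitVec μ)) =
      β⁻¹ * (2 * d * CetaM d 1 (α ^ 2) (x - c) -
        ∑ μ : Fin d, (CetaM d 1 (α ^ 2) (x - c + unitVec μ) + CetaM d 1 (α ^ 2) (x - c - unitVec μ)) +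
        α ^ 2 * CetaM d 1 (α ^ 2) (x - c)) := by ring
  rw [hL, key]
  by_cases h : x = c
  · rw [if_pos h, if_pos (hxc.1 h), mul_one]
  · rw [if_neg h, if_neg (fun h' => h (hxc.2 h')), mul_zero]

/-- **A uniform bound on the free covariance**: `|K(x, c)| ≤ 1/(βα²)` (r15's a-priori bound `|C^ξ| ≤ ξ^{−d}`).
[cite: BenfattoEtAl1978, (C.5) p.164] -/
theorem abs_freeCov_le {α β : ℝ} (hα : 0 < α) (hβ : 0 < β) (x c : B1Eq324BenfattoLemma.Site d) :
    |freeCov d α β x c| ≤ β⁻¹ * (α ^ 2)⁻¹ := by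
  have hsq : Real.sqrt (α ^ 2) = α := Real.sqrt_sq hα.le
  simp only [freeCov, CetaM, hsq, one_mul]
  rw [abs_mul, abs_of_pos (inv_pos.2 hβ), abs_mul, abs_of_pos (by positivity : (0 : ℝ) < α ^ d / α ^ 2)]
  refine mul_le_mul_of_nonneg_left ?_ (inv_pos.2 hβ).le
  have h := abs_Cxi_le (d := d) hα (x - c)
  calc α ^ d / α ^ 2 * |Cxi d α (x - c)| ≤ α ^ d / α ^ 2 * α⁻¹ ^ d :=
        mul_le_mul_of_nonneg_left h (by positivity)
    _ = (α ^ 2)⁻¹ := by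
        rw [inv_pow]
        field_simp

/-! ## §2  The regression mean `u = condMean K Γ z̄` as a kernel combination -/

section Regression

variable (G : B1Eq324BenfattoLemma.Site d → B1Eq324BenfattoLemma.Site d → ℝ) (Γ : Finset (B1Eq324BenfattoLemma.Site d))
  (zbar : B1Eq324BenfattoLemma.Site d → ℝ)

/-- **`u(x) = Σ_{c∈Γ} K(x, c)·a_c`** with the coefficient vector `a = (K_ΓΓ)⁻¹ z̄|_Γ`. [cite: BenfattoEtAl1978, (C.7) p.164] -/
theorem condMean_eq_sum_mul (x : B1Eq324BenfattoLemma.Site d) :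
    condMean G Γ zbar x = ∑ c : Γ, G x c * ((covGram G Γ)⁻¹ *ᵥ fun c' : Γ => zbar c') c := by
  simp only [condMean, Matrix.mulVec, dotProduct, Finset.mul_sum]
  refine Finset.sum_congr rfl fun c _ => Finset.sum_congr rfl fun c' _ => ?_
  ring

/-- **On Γ the regression mean reproduces the data** when the Gram matrix `K_ΓΓ` is invertible: `u(c) = z̄_c`, `c ∈ Γ`
(`K_ΓΓ (K_ΓΓ)⁻¹ = 1`). [cite: BenfattoEtAl1978, (C.7) p.164] -/
theorem condMean_apply_of_mem (hdet : IsUnit (covGram G Γ).det) {x : B1Eq324BenfattoLemma.Site d} (hx : x ∈ Γ) :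
    condMean G Γ zbar x = zbar x := by
  rw [condMean_eq_sum_mul]
  have h : ∑ c : Γ, G x c * ((covGram G Γ)⁻¹ *ᵥ fun c' : Γ => zbar c') c =
      (covGram G Γ *ᵥ ((covGram G Γ)⁻¹ *ᵥ fun c' : Γ => zbar c')) ⟨x, hx⟩ := by
    simp only [Matrix.mulVec, dotProduct, covGram_apply]
  rw [h, Matrix.mulVec_mulVec, Matrix.mul_nonsing_inv _ hdet, Matrix.one_mulVec]

/-- For a singular Gram matrix Mathlib's inverse is `0`, so the tree's regression mean vanishes identically (and every bound on it
holds trivially). [folklore] -/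
private theorem condMean_eq_zero_of_not_isUnit (hdet : ¬IsUnit (covGram G Γ).det) (x : B1Eq324BenfattoLemma.Site d) :
    condMean G Γ zbar x = 0 := by
  rw [condMean_eq_sum_mul, Matrix.nonsing_inv_apply_not_isUnit _ hdet]
  simp

end Regression

/-- **The regression mean of the free field is massive-harmonic off Γ**: for `x ∉ Γ`,
`(2d + α²)·u(x) = Σ_μ (u(x + e_μ) + u(x − e_μ))` (each `K(·, c)`, `c ∈ Γ`, solves the lattice equation away from `c`) — the
content of «Dirichelet boundary condition on Γ» / (C.7) for the centre. [cite: BenfattoEtAl1978, (C.7) p.164] -/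
theorem condMean_freeCov_harmonic {α : ℝ} (β : ℝ) (hα : 0 < α) (Γ : Finset (B1Eq324BenfattoLemma.Site d))
    (zbar : B1Eq324BenfattoLemma.Site d → ℝ) {x : B1Eq324BenfattoLemma.Site d} (hx : x ∉ Γ) :
    (2 * d + α ^ 2) * condMean (freeCov d α β) Γ zbar x =
      ∑ μ : Fin d, (condMean (freeCov d α β) Γ zbar (x + unitVec μ) + condMean (freeCov d α β) Γ zbar (x - unitVec μ)) := by
  set a : Γ → ℝ := (covGram (freeCov d α β) Γ)⁻¹ *ᵥ fun c' : Γ => zbar c' with ha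
  simp only [condMean_eq_sum_mul, ← ha]
  rw [Finset.mul_sum]
  have hrhs : ∑ μ : Fin d, (∑ c : Γ, freeCov d α β (x + unitVec μ) c * a c + ∑ c : Γ, freeCov d α β (x - unitVec μ) c * a c) =
      ∑ c : Γ, (∑ μ : Fin d, (freeCov d α β (x + unitVec μ) c + freeCov d α β (x - unitVec μ) c)) * a c := by
    calc ∑ μ : Fin d, (∑ c : Γ, freeCov d α β (x + unitVec μ) c * a c + ∑ c : Γ, freeCov d α β (x - unitVec μ) c * a c)
        = ∑ μ : Fin d, ∑ c : Γ, (freeCov d α β (x + unitVec μ) c * a c + freeCov d α β (x - unitVec μ) c * a c) := by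
          refine Finset.sum_congr rfl fun μ _ => ?_
          rw [← Finset.sum_add_distrib]
      _ = ∑ c : Γ, ∑ μ : Fin d, (freeCov d α β (x + unitVec μ) c * a c + freeCov d α β (x - unitVec μ) c * a c) :=
          Finset.sum_comm
      _ = ∑ c : Γ, (∑ μ : Fin d, (freeCov d α β (x + unitVec μ) c + freeCov d α β (x - unitVec μ) c)) * a c := by
          refine Finset.sum_congr rfl fun c _ => ?_
          rw [Finset.sum_mul]
          refine Finset.sum_congr rfl fun μ _ => ?_
          ring
  rw [hrhs]
  refine Finset.sum_congr rfl fun c _ => ?_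
  have hxc : x ≠ (c : B1Eq324BenfattoLemma.Site d) := fun h => hx (h ▸ c.2)
  have key := freeCov_lattice_eq (d := d) β hα x c
  rw [if_neg hxc, sub_eq_zero] at key
  rw [← mul_assoc, key]

/-- **The regression mean is bounded**: `|u(x)| ≤ (βα²)⁻¹·Σ_c |a_c|` uniformly in `x`. [folklore] -/
private theorem abs_condMean_le_const {α β : ℝ} (hα : 0 < α) (hβ : 0 < β) (Γ : Finset (B1Eq324BenfattoLemma.Site d))
    (zbar : B1Eq324BenfattoLemma.Site d → ℝ) (x : B1Eq324BenfattoLemma.Site d) :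
    |condMean (freeCov d α β) Γ zbar x| ≤
      β⁻¹ * (α ^ 2)⁻¹ * ∑ c : Γ, |((covGram (freeCov d α β) Γ)⁻¹ *ᵥ fun c' : Γ => zbar c') c| := by
  rw [condMean_eq_sum_mul, Finset.mul_sum]
  refine (Finset.abs_sum_le_sum_abs _ _).trans (Finset.sum_le_sum fun c _ => ?_)
  rw [abs_mul]
  exact mul_le_mul_of_nonneg_right (abs_freeCov_le hα hβ x c) (abs_nonneg _)

/-! ## §3  Geometry: `d(Δ, I)` is 1-Lipschitz under unit steps of `Δ` -/

/-- The per-axis gap `max(|t| − 1, 0)` is 1-Lipschitz. [folklore] -/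
private theorem abs_gap_sub_gap_le (s t : ℝ) : |max (|s| - 1) 0 - max (|t| - 1) 0| ≤ |s - t| := by
  refine (abs_max_sub_max_le_max (|s| - 1) 0 (|t| - 1) 0).trans ?_
  rw [sub_self, abs_zero, sub_sub_sub_cancel_right]
  exact max_le (abs_abs_sub_abs_le_abs_sub s t) (abs_nonneg _)

/-- **One step changes the cube distance by at most one**: `|dist(Δ_{x+σe_μ}, Δ_y) − dist(Δ_x, Δ_y)| ≤ 1` for `σ = ±1` (only the
`μ`-th gap changes, by at most `1`; the Euclidean norm is 1-Lipschitz). [cite: BenfattoEtAl1978, after (2.3) p.146] -/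
theorem abs_cubeDist_step_sub_le (x y : B1Eq324BenfattoLemma.Site d) (μ : Fin d) {σ : ℤ} (hσ : σ = 1 ∨ σ = -1) :
    |cubeDist (x + σ • unitVec μ) y - cubeDist x y| ≤ 1 := by
  -- the two gap vectors as points of `EuclideanSpace ℝ (Fin d)`
  set g : Fin d → ℝ := fun j => max (|((x j : ℝ) - (y j : ℝ))| - 1) 0 with hg
  set g' : Fin d → ℝ := fun j => max (|(((x + σ • unitVec μ) j : ℝ) - (y j : ℝ))| - 1) 0 with hg'
  have hnorm : ∀ f : Fin d → ℝ, Real.sqrt (∑ j, f j ^ 2) = ‖(WithLp.toLp 2 f : EuclideanSpace ℝ (Fin d))‖ := by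
    intro f
    rw [EuclideanSpace.norm_eq]
    congr 1
    refine Finset.sum_congr rfl fun j _ => ?_
    rw [show (WithLp.toLp 2 f : EuclideanSpace ℝ (Fin d)) j = f j from rfl, Real.norm_eq_abs, sq_abs]
  have h1 : cubeDist x y = ‖(WithLp.toLp 2 g : EuclideanSpace ℝ (Fin d))‖ := hnorm g
  have h2 : cubeDist (x + σ • unitVec μ) y = ‖(WithLp.toLp 2 g' : EuclideanSpace ℝ (Fin d))‖ := hnorm g'
  rw [h1, h2]
  refine (abs_norm_sub_norm_le _ _).trans ?_
  -- `‖g' − g‖ = |g'_μ − g_μ| ≤ 1`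
  have hdiff : (WithLp.toLp 2 g' : EuclideanSpace ℝ (Fin d)) - WithLp.toLp 2 g = WithLp.toLp 2 (g' - g) := rfl
  rw [hdiff, ← hnorm (g' - g)]
  have hoff : ∀ j, j ≠ μ → (g' - g) j = 0 := by
    intro j hj
    simp only [Pi.sub_apply, hg, hg', Pi.add_apply, Pi.smul_apply, unitVec, Pi.single_apply, if_neg hj, smul_zero,
      add_zero, sub_self]
  have hsum : ∑ j, (g' - g) j ^ 2 = (g' - g) μ ^ 2 := by
    rw [Finset.sum_eq_single μ (fun j _ hj => by rw [hoff j hj]; ring) (fun h => absurd (Finset.mem_univ μ) h)]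
  rw [hsum, Real.sqrt_sq_eq_abs]
  have hμ : (g' - g) μ = max (|(((x μ + σ : ℤ) : ℝ) - (y μ : ℝ))| - 1) 0 - max (|((x μ : ℝ) - (y μ : ℝ))| - 1) 0 := by
    simp only [Pi.sub_apply, hg, hg', Pi.add_apply, Pi.smul_apply, unitVec, Pi.single_eq_same, smul_eq_mul, mul_one]
  rw [hμ]
  refine (abs_gap_sub_gap_le _ _).trans ?_
  push_cast
  rcases hσ with h | h <;> simp [h]

/-- **One step changes `d(Δ, I)` by at most one**: `|d(Δ_{x+σe_μ}, I) − d(Δ_x, I)| ≤ 1`, `σ = ±1` (an infimum of 1-Lipschitz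
functions). [cite: BenfattoEtAl1978, after (2.3) p.146] -/
theorem abs_distToRegion_step_sub_le (I : Finset (B1Eq324BenfattoLemma.Site d)) (x : B1Eq324BenfattoLemma.Site d) (μ : Fin d)
    {σ : ℤ} (hσ : σ = 1 ∨ σ = -1) :
    |distToRegion I (x + σ • unitVec μ) - distToRegion I x| ≤ 1 := by
  by_cases hI : I.Nonempty
  · obtain ⟨y₀, hy₀, h₀⟩ := exists_mem_distToRegion_eq hI x
    obtain ⟨y₁, hy₁, h₁⟩ := exists_mem_distToRegion_eq hI (x + σ • unitVec μ)
    have hle₀ : distToRegion I (x + σ • unitVec μ) ≤ cubeDist (x + σ • unitVec μ) y₀ := by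
      rw [distToRegion, dif_pos hI]
      exact Finset.inf'_le _ hy₀
    have hle₁ : distToRegion I x ≤ cubeDist x y₁ := by
      rw [distToRegion, dif_pos hI]
      exact Finset.inf'_le _ hy₁
    have ha := abs_cubeDist_step_sub_le x y₀ μ hσ
    have hb := abs_cubeDist_step_sub_le x y₁ μ hσ
    rw [abs_le] at ha hb ⊢
    constructor <;> linarith [ha.1, ha.2, hb.1, hb.2]
  · simp [distToRegion, hI]

/-! ## §4  The massive maximum principle on `ℤ^d ∖ Γ` and the centre bound -/

/-- **Maximum principle for bounded subsolutions** of the massive discrete operator on the complement of a finite set: if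
`w ≤ B`, `w ≤ 0` on `Γ`, and `(2d + κ)·w(x) ≤ Σ_μ (w(x + e_μ) + w(x − e_μ))` for `x ∉ Γ` with `κ > 0`, then `w ≤ 0` everywhere
(take `x` with `w(x)` close to `sup w`: the mass `κ` forbids a positive supremum; no maximiser is needed). [folklore] -/
private theorem le_of_subsolution {κ B : ℝ} (hκ : 0 < κ) (Γ : Finset (B1Eq324BenfattoLemma.Site d))
    {w : B1Eq324BenfattoLemma.Site d → ℝ} (hB : ∀ x, w x ≤ B) (hΓ : ∀ x ∈ Γ, w x ≤ 0)
    (hsub : ∀ x ∉ Γ, (2 * d + κ) * w x ≤ ∑ μ : Fin d, (w (x + unitVec μ) + w (x - unitVec μ))) :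
    ∀ x, w x ≤ 0 := by
  have hbdd : BddAbove (Set.range w) := ⟨B, by rintro _ ⟨x, rfl⟩; exact hB x⟩
  set S : ℝ := ⨆ x, w x with hS
  have hwS : ∀ x, w x ≤ S := fun x => le_ciSup hbdd x
  by_contra hcon
  push Not at hcon
  obtain ⟨x₀, hx₀⟩ := hcon
  have hSpos : 0 < S := hx₀.trans_le (hwS x₀)
  have h2d : (0 : ℝ) ≤ 2 * d := by positivity
  -- a point where `w` exceeds the fraction `2d/(2d+κ)` of the supremum
  have hθ : 2 * d / (2 * d + κ) * S < S := by
    rw [div_mul_eq_mul_div, div_lt_iff₀ (by positivity)]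
    nlinarith
  obtain ⟨x₁, hx₁⟩ : ∃ x₁, 2 * d / (2 * d + κ) * S < w x₁ := exists_lt_of_lt_ciSup hθ
  have hx₁Γ : x₁ ∉ Γ := by
    intro h
    have := hΓ x₁ h
    have : 0 ≤ 2 * d / (2 * d + κ) * S := by positivity
    linarith
  have hnb : ∑ μ : Fin d, (w (x₁ + unitVec μ) + w (x₁ - unitVec μ)) ≤ 2 * d * S := by
    calc ∑ μ : Fin d, (w (x₁ + unitVec μ) + w (x₁ - unitVec μ)) ≤ ∑ _μ : Fin d, (S + S) :=
          Finset.sum_le_sum fun μ _ => add_le_add (hwS _) (hwS _)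
      _ = 2 * d * S := by
          rw [Finset.sum_const, Finset.card_univ, Fintype.card_fin, nsmul_eq_mul]
          ring
  have h3 := (hsub x₁ hx₁Γ).trans hnb
  have h4 : w x₁ ≤ 2 * d / (2 * d + κ) * S := by
    rw [div_mul_eq_mul_div, le_div_iff₀ (by positivity)]
    linarith
  linarith

/-- **THE CONDITIONAL CENTRE BOUND ((C.8)-type)**: for the free field (1.1) (`α, β > 0`), a conditioning region `Γ`, a region `I`
and boundary data with `|z̄_c| ≤ γb(1 + d(Δ_c, I))` on `Γ` (`γb ≥ 0`), the regression mean `u = condMean (freeCov d α β) Γ z̄`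
obeys `|u(x)| ≤ γb·(1 + d(Δ_x, I) + 2d/α²)` at EVERY site — the profile `γb(1 + d(·, I) + 2d/α²)` is a supersolution of
`(−Δ + α²)`, `u` is a bounded solution off `Γ` dominated by it on `Γ`, and the maximum principle concludes.
[cite: BenfattoEtAl1978, Appendix C (C.8) p.164] -/
theorem abs_condMean_freeCov_le {α β γ b : ℝ} (hα : 0 < α) (hβ : 0 < β) (hγb : 0 ≤ γ * b)
    (Γ I : Finset (B1Eq324BenfattoLemma.Site d)) (zbar : B1Eq324BenfattoLemma.Site d → ℝ)
    (hz : ∀ c ∈ Γ, |zbar c| ≤ γ * b * (1 + distToRegion I c)) (x : B1Eq324BenfattoLemma.Site d) :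
    |condMean (freeCov d α β) Γ zbar x| ≤ γ * b * (1 + distToRegion I x + 2 * d / α ^ 2) := by
  have hα2 : 0 < α ^ 2 := by positivity
  have hvnn : ∀ y, 0 ≤ γ * b * (1 + distToRegion I y + 2 * d / α ^ 2) := fun y =>
    mul_nonneg hγb (by have := distToRegion_nonneg I y; positivity)
  by_cases hdet : IsUnit (covGram (freeCov d α β) Γ).det
  swap
  · rw [condMean_eq_zero_of_not_isUnit _ _ _ hdet, abs_zero]
    exact hvnn x
  -- notation
  set u : B1Eq324BenfattoLemma.Site d → ℝ := condMean (freeCov d α β) Γ zbar with hu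
  set v : B1Eq324BenfattoLemma.Site d → ℝ := fun y => γ * b * (1 + distToRegion I y + 2 * d / α ^ 2) with hv
  -- `u` is bounded
  obtain ⟨B₀, hB₀⟩ : ∃ B₀, ∀ y, |u y| ≤ B₀ :=
    ⟨_, fun y => abs_condMean_le_const hα hβ Γ zbar y⟩
  -- `v` is a supersolution: one step moves it by at most `γb`
  have hvstep : ∀ (y : B1Eq324BenfattoLemma.Site d) (μ : Fin d) (σ : ℤ), σ = 1 ∨ σ = -1 →
      v (y + σ • unitVec μ) ≤ v y + γ * b := by
    intro y μ σ hσ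
    have h := abs_distToRegion_step_sub_le I y μ hσ
    rw [abs_le] at h
    simp only [hv]
    nlinarith [h.2, hγb]
  have hvsuper : ∀ y, ∑ μ : Fin d, (v (y + unitVec μ) + v (y - unitVec μ)) ≤ (2 * d + α ^ 2) * v y := by
    intro y
    have hplus : ∀ μ : Fin d, v (y + unitVec μ) ≤ v y + γ * b := fun μ => by
      simpa using hvstep y μ 1 (Or.inl rfl)
    have hminus : ∀ μ : Fin d, v (y - unitVec μ) ≤ v y + γ * b := fun μ => by
      have := hvstep y μ (-1) (Or.inr rfl)
      simpa [sub_eq_add_neg] using this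
    calc ∑ μ : Fin d, (v (y + unitVec μ) + v (y - unitVec μ)) ≤ ∑ _μ : Fin d, ((v y + γ * b) + (v y + γ * b)) :=
          Finset.sum_le_sum fun μ _ => add_le_add (hplus μ) (hminus μ)
      _ = 2 * d * v y + 2 * d * (γ * b) := by
          rw [Finset.sum_const, Finset.card_univ, Fintype.card_fin, nsmul_eq_mul]
          ring
      _ ≤ (2 * d + α ^ 2) * v y := by
          have hd0 : 0 ≤ distToRegion I y := distToRegion_nonneg I y
          have hkey : 2 * d * (γ * b) ≤ α ^ 2 * v y := by
            simp only [hv]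
            have : α ^ 2 * (γ * b * (1 + distToRegion I y + 2 * d / α ^ 2)) =
                γ * b * (α ^ 2 * (1 + distToRegion I y)) + 2 * d * (γ * b) := by
              field_simp
            rw [this]
            nlinarith [mul_nonneg hγb (mul_nonneg hα2.le (by linarith : (0:ℝ) ≤ 1 + distToRegion I y))]
          nlinarith
  -- boundary domination on Γ
  have hΓ : ∀ c ∈ Γ, |u c| ≤ v c := by
    intro c hc
    simp only [hu, hv]
    rw [condMean_apply_of_mem _ _ _ hdet hc]
    refine (hz c hc).trans ?_
    have : 0 ≤ γ * b * (2 * d / α ^ 2) := mul_nonneg hγb (by positivity)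
    nlinarith
  -- harmonicity off Γ
  have hharm : ∀ y ∉ Γ, (2 * d + α ^ 2) * u y = ∑ μ : Fin d, (u (y + unitVec μ) + u (y - unitVec μ)) :=
    fun y hy => condMean_freeCov_harmonic β hα Γ zbar hy
  -- apply the maximum principle to `u − v` and to `−u − v`
  have hup : ∀ y, u y - v y ≤ 0 := by
    refine le_of_subsolution (κ := α ^ 2) (B := B₀) hα2 Γ (fun y => ?_) (fun c hc => ?_) (fun y hy => ?_)
    · linarith [(abs_le.1 (hB₀ y)).2, hvnn y]
    · linarith [(abs_le.1 (hΓ c hc)).2]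
    · have h1 := hharm y hy
      have h2 := hvsuper y
      have : ∑ μ : Fin d, ((u (y + unitVec μ) - v (y + unitVec μ)) + (u (y - unitVec μ) - v (y - unitVec μ))) =
          ∑ μ : Fin d, (u (y + unitVec μ) + u (y - unitVec μ)) - ∑ μ : Fin d, (v (y + unitVec μ) + v (y - unitVec μ)) := by
        rw [← Finset.sum_sub_distrib]
        refine Finset.sum_congr rfl fun μ _ => ?_
        ring
      rw [this]
      nlinarith
  have hdown : ∀ y, -u y - v y ≤ 0 := by
    refine le_of_subsolution (κ := α ^ 2) (B := B₀) hα2 Γ (fun y => ?_) (fun c hc => ?_) (fun y hy => ?_)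
    · linarith [(abs_le.1 (hB₀ y)).1, hvnn y]
    · linarith [(abs_le.1 (hΓ c hc)).1]
    · have h1 := hharm y hy
      have h2 := hvsuper y
      have : ∑ μ : Fin d, ((-u (y + unitVec μ) - v (y + unitVec μ)) + (-u (y - unitVec μ) - v (y - unitVec μ))) =
          -∑ μ : Fin d, (u (y + unitVec μ) + u (y - unitVec μ)) - ∑ μ : Fin d, (v (y + unitVec μ) + v (y - unitVec μ)) := by
        rw [← Finset.sum_neg_distrib, ← Finset.sum_sub_distrib]
        refine Finset.sum_congr rfl fun μ _ => ?_
        ring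
      rw [this]
      nlinarith
  exact abs_le.2 ⟨by linarith [hdown x], by linarith [hup x]⟩

/-- **(C.8) in print's shape**: under the hypotheses of `abs_condMean_freeCov_le`,
`|u_Δ| ≤ (1 + 2d/α²)·γb·(1 + d(Δ, I))` — print: `|u_Δ| ≦ ((α² + 2d)/α²)² b(1 + d(Δ, I))` for data `|z_Δ| < b(1 + d(Δ, I))`;
the constant here, `(α² + 2d)/α²`, is the one the maximum-principle proof yields. [cite: BenfattoEtAl1978, Appendix C (C.8) p.164] -/
theorem abs_condMean_freeCov_le' {α β γ b : ℝ} (hα : 0 < α) (hβ : 0 < β) (hγb : 0 ≤ γ * b)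
    (Γ I : Finset (B1Eq324BenfattoLemma.Site d)) (zbar : B1Eq324BenfattoLemma.Site d → ℝ)
    (hz : ∀ c ∈ Γ, |zbar c| ≤ γ * b * (1 + distToRegion I c)) (x : B1Eq324BenfattoLemma.Site d) :
    |condMean (freeCov d α β) Γ zbar x| ≤ (1 + 2 * d / α ^ 2) * (γ * b) * (1 + distToRegion I x) := by
  refine (abs_condMean_freeCov_le hα hβ hγb Γ I zbar hz x).trans ?_
  have hd0 : 0 ≤ distToRegion I x := distToRegion_nonneg I x
  have hq : 0 ≤ 2 * (d : ℝ) / α ^ 2 := by positivity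
  nlinarith [mul_nonneg hγb (mul_nonneg hq hd0)]

end Literature.MathematicalPhysics.QuantumFieldTheory.Balaban1983to89.B1Eq324BenfattoCondCentre

end
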